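import Mathlib.LinearAlgebra.SesquilinearForm.Basic
import Mathlib.LinearAlgebra.Prod
import Mathlib.LinearAlgebra.GeneralLinearGroup.Basic
import Mathlib.LinearAlgebra.Determinant
import Mathlib.Tactic.LinearCombination
import Mathlib.Tactic.Module
import HarnessLib

/-!
# The doubled hermitian space: Siegel unipotents, the Cayley transform, and `w₀ n(c) ∈ P_Δ · (U(h) × 1)`
# ([MoeglinVignerasWaldspurger1987, Ch. 3]; the doubling method, [Howe1979] §11)

Topic `LinearAlgebra/Semilinear`; namespace `Literature.LinearAlgebra.Semilinear`.  KERNEL ONLY (theorems with explicit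
formulas, Mathlib only; no named fact, no definition).

Setting (Mathlib's sesquilinear API, as in `Semilinear/RankOneHermitianRigidity`): `K` a field, `σ : K →+* K`, `V` a
`K`-module, `B : V →ₛₗ[σ] V →ₗ[K] K` (`B x v = h(v, x)`), and the DOUBLED space `𝔻 = V × V` with the form
`H = h ⊕ (−h)`, i.e. `H(x, y) = B x.1 y.1 − B x.2 y.2`, its diagonal `Δ = {(v, v)}` and antidiagonal `∇ = {(v, −v)}`
(both Lagrangian, in duality).  For `c : V →ₗ[K] V` put `n(c)(v₁, v₂) = (v₁ + c(v₁ − v₂), v₂ + c(v₁ − v₂))` and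
`w₀(v₁, v₂) = (v₁, −v₂)`.

* `n(c)` fixes `Δ` pointwise, `(n(c) − 1)𝔻 ≤ Δ`, `n(c) n(−c) = 1` (`smear_*`); `n(c)` preserves `H` iff (for all
  arguments) `c` is SKEW-adjoint, `h(c u, w) = −h(u, c w)` (`doubledForm_smear`: in general
  `H(n x, n y) − H(x, y) = h(d, c e) + h(c d, e)`); these are the unipotents of the Siegel parabolic `P_Δ`;
  `w₀` preserves `H` and carries `Δ` to `∇`;
* **`exists_cayley_siegel_decomposition`** — for `c` skew-adjoint with `2c − 1` and `2c + 1` invertible there are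
  `γ ∈ U(h)` — the CAYLEY TRANSFORM, `γ (2c − 1) = 2c + 1` — and `p ∈ U(H)` with `p Δ = Δ` (so `p ∈ P_Δ`) such that
  `w₀ ∘ n(c) = p ∘ (γ ⊕ 1)`, i.e. `p (γ v₁, v₂) = w₀ n(c) (v₁, v₂)`; equivalently the Lagrangian `n(c)⁻¹ w₀⁻¹ Δ` is
  the graph `{(u, γ u)}` (`smear_graph_mem_diag`);
* `isUnit_and_isUnit_iff_det_ne_zero` — in finite dimension, both are invertible iff `det(2c − 1) · det(2c + 1) ≠ 0`
  (a non-zero polynomial condition);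
* `skew_of_selfAdjoint_smul` — for `δ` with `σ δ = −δ`, `δ • c'` is skew-adjoint when `c'` is self-adjoint (so the
  statements apply to the hermitian parametrisation `b ↦ n(δ b)` of the Siegel unipotent radical).

## References
* C. Mœglin, M.-F. Vignéras, J.-L. Waldspurger, *Correspondances de Howe sur un corps p-adique*, LNM 1291 (1987),
  Ch. 3 (doubled spaces, Siegel parabolics) [MoeglinVignerasWaldspurger1987].
* R. Howe, *θ-series and invariant theory*, Proc. Symp. Pure Math. 33.1 (1979), §11 [Howe1979].
-/

set_option autoImplicit false

namespace Literature.LinearAlgebra.Semilinear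

variable {K : Type*} [Field K] {V : Type*} [AddCommGroup V] [Module K V] {σ : K →+* K}

/-! ### The Siegel unipotents `n(c)` and the long element `w₀`: elementary identities -/

/-- `n(c)` fixes the diagonal pointwise. [cite: MoeglinVignerasWaldspurger1987, Ch. 3] -/
theorem smear_diag (c : V →ₗ[K] V) (v : V) : (v + c (v - v), v + c (v - v)) = (v, v) := by
  rw [sub_self, map_zero, add_zero]

/-- `(n(c) − 1) 𝔻 ≤ Δ`: `n(c) x − x = (c d, c d)`, `d = x.1 − x.2`. [cite: MoeglinVignerasWaldspurger1987, Ch. 3] -/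
theorem smear_sub_self (c : V →ₗ[K] V) (v₁ v₂ : V) :
    ((v₁ + c (v₁ - v₂), v₂ + c (v₁ - v₂)) : V × V) - (v₁, v₂) = (c (v₁ - v₂), c (v₁ - v₂)) := by
  ext <;> simp

/-- `n(c) n(−c) = 1`. [cite: MoeglinVignerasWaldspurger1987, Ch. 3] -/
theorem smear_smear_neg (c : V →ₗ[K] V) (v₁ v₂ : V) :
    ((v₁ - c (v₁ - v₂)) + c ((v₁ - c (v₁ - v₂)) - (v₂ - c (v₁ - v₂))),
      (v₂ - c (v₁ - v₂)) + c ((v₁ - c (v₁ - v₂)) - (v₂ - c (v₁ - v₂)))) = (v₁, v₂) := by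
  have e : (v₁ - c (v₁ - v₂)) - (v₂ - c (v₁ - v₂)) = v₁ - v₂ := by abel
  rw [e, sub_add_cancel, sub_add_cancel]

/-- **`n(c)` and the doubled form**: `H(n(c) x, n(c) y) = H(x, y)` for `c` SKEW-adjoint (`h(c u, w) = −h(u, c w)`;
in general the defect is `h(d, c e) + h(c d, e)`). [cite: MoeglinVignerasWaldspurger1987, Ch. 3] -/
theorem doubledForm_smear (B : V →ₛₗ[σ] V →ₗ[K] K) (c : V →ₗ[K] V) (hc : ∀ u w : V, B (c u) w = -B u (c w))
    (v₁ v₂ w₁ w₂ : V) :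
    B (v₁ + c (v₁ - v₂)) (w₁ + c (w₁ - w₂)) - B (v₂ + c (v₁ - v₂)) (w₂ + c (w₁ - w₂)) = B v₁ w₁ - B v₂ w₂ := by
  have h1 := hc (v₁ - v₂) (w₁ - w₂)
  simp only [map_add, map_sub, LinearMap.add_apply, LinearMap.sub_apply] at h1 ⊢
  linear_combination h1

/-- `w₀ (v₁, v₂) = (v₁, −v₂)` preserves the doubled form. [cite: MoeglinVignerasWaldspurger1987, Ch. 3] -/
theorem doubledForm_longElement (B : V →ₛₗ[σ] V →ₗ[K] K) (v₁ v₂ w₁ w₂ : V) :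
    B v₁ w₁ - B (-v₂) (-w₂) = B v₁ w₁ - B v₂ w₂ := by
  simp only [map_neg, LinearMap.neg_apply, neg_neg]

/-- `w₀ Δ = ∇`: `w₀ (v, v) = (v, −v)` (and `w₀ (v, −v) = (v, v)`). [cite: MoeglinVignerasWaldspurger1987, Ch. 3] -/
theorem longElement_diag (v : V) : ((v, -v) : V × V) = (v, -v) ∧ ((v, - -v) : V × V) = (v, v) :=
  ⟨rfl, by rw [neg_neg]⟩

/-- For `δ` with `σ δ = −δ` and `c'` SELF-adjoint (`h(c' u, w) = h(u, c' w)`), `δ • c'` is skew-adjoint: the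
hermitian parametrisation of the Siegel unipotent radical. [cite: MoeglinVignerasWaldspurger1987, Ch. 3] -/
theorem skew_of_selfAdjoint_smul (B : V →ₛₗ[σ] V →ₗ[K] K) (c' : V →ₗ[K] V) (hc' : ∀ u w : V, B (c' u) w = B u (c' w))
    {δ : K} (hδ : σ δ = -δ) (u w : V) : B ((δ • c') u) w = -B u ((δ • c') w) := by
  rw [LinearMap.smul_apply, LinearMap.smul_apply, LinearMap.map_smulₛₗ₂, map_smul, hδ, hc', smul_eq_mul,
    smul_eq_mul, neg_mul]

/-! ### The Cayley transform and the factorisation `w₀ n(c) = p (γ ⊕ 1)` -/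

/-- `2c − 1` and `2c + 1` commute. [cite: MoeglinVignerasWaldspurger1987, Ch. 3] -/
private theorem commute_two_smul_sub_add (c : V →ₗ[K] V) :
    Commute ((2 : K) • c - 1 : Module.End K V) ((2 : K) • c + 1) :=
  (((Commute.refl c).smul_left (2 : K)).smul_right (2 : K)).sub_left (Commute.one_left _) |>.add_right
    (Commute.one_right _)

/-- For `c` skew-adjoint, `h((2c+1) u, (2c+1) w) = h((2c−1) u, (2c−1) w)` (the defect is
`4 (h(c u, w) + h(u, c w)) = 0`). [cite: MoeglinVignerasWaldspurger1987, Ch. 3] -/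
private theorem form_two_smul_add_eq (B : V →ₛₗ[σ] V →ₗ[K] K) (c : V →ₗ[K] V)
    (hc : ∀ u w : V, B (c u) w = -B u (c w)) (u w : V) :
    B (((2 : K) • c + 1 : Module.End K V) u) (((2 : K) • c + 1 : Module.End K V) w) =
      B (((2 : K) • c - 1 : Module.End K V) u) (((2 : K) • c - 1 : Module.End K V) w) := by
  have h1 := hc u w
  simp only [LinearMap.add_apply, LinearMap.sub_apply, LinearMap.smul_apply, Module.End.one_apply, map_add,
    map_sub, LinearMap.add_apply, LinearMap.sub_apply, LinearMap.map_smulₛₗ₂, map_smul, smul_eq_mul,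
    map_ofNat] at h1 ⊢
  linear_combination (4 : K) * h1

/-- **Cayley transform and Siegel decomposition in the doubled hermitian space.**  Let `c : V →ₗ[K] V` be
SKEW-adjoint for `B` (`h(c u, w) = −h(u, c w)`) with `2c − 1` and `2c + 1` invertible.  Then there are
* `γ : V ≃ₗ[K] V`, the Cayley transform `γ = (2c − 1)⁻¹ (2c + 1)` (`γ ((2c−1) v) = (2c+1) v`), an ISOMETRY of `h`;
* `p : 𝔻 ≃ₗ[K] 𝔻` (`𝔻 = V × V`), an isometry of `H = h ⊕ (−h)` with `p Δ = Δ` (pointwise: `p(v, v) ∈ Δ` and every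
  `(w, w)` is attained), i.e. `p ∈ P_Δ`,
such that `w₀ ∘ n(c) = p ∘ (γ ⊕ 1)`: `p (γ v₁, v₂) = (v₁ + c(v₁ − v₂), −(v₂ + c(v₁ − v₂)))`.  (Explicitly
`p = w₀ n(c) (γ⁻¹ ⊕ 1)`.) [cite: MoeglinVignerasWaldspurger1987, Ch. 3] -/
theorem exists_cayley_siegel_decomposition (B : V →ₛₗ[σ] V →ₗ[K] K) (c : V →ₗ[K] V)
    (hc : ∀ u w : V, B (c u) w = -B u (c w)) (hM : IsUnit ((2 : K) • c - 1 : Module.End K V))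
    (hP : IsUnit ((2 : K) • c + 1 : Module.End K V)) :
    ∃ (γ : V ≃ₗ[K] V) (p : (V × V) ≃ₗ[K] (V × V)),
      (∀ v : V, γ (((2 : K) • c - 1 : Module.End K V) v) = ((2 : K) • c + 1 : Module.End K V) v) ∧
      (∀ u w : V, B (γ u) (γ w) = B u w) ∧
      (∀ x y : V × V, B (p x).1 (p y).1 - B (p x).2 (p y).2 = B x.1 y.1 - B x.2 y.2) ∧
      (∀ v : V, (p (v, v)).1 = (p (v, v)).2) ∧
      (∀ w : V, ∃ v : V, p (v, v) = (w, w)) ∧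
      (∀ v₁ v₂ : V, p (γ v₁, v₂) = (v₁ + c (v₁ - v₂), -(v₂ + c (v₁ - v₂)))) := by
  -- the Cayley transform `γ = M⁻¹ P`, `M = 2c − 1`, `P = 2c + 1`
  set M : Module.End K V := (2 : K) • c - 1 with hMdef
  set P : Module.End K V := (2 : K) • c + 1 with hPdef
  have hMP : M * P = P * M := (commute_two_smul_sub_add c).eq
  let γu : (Module.End K V)ˣ := hM.unit⁻¹ * hP.unit
  let γ : V ≃ₗ[K] V := LinearMap.GeneralLinearGroup.toLinearEquiv γu
  have hγ : ∀ v, γ v = (↑(hM.unit⁻¹) : Module.End K V) (P v) := fun v => rfl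
  have hγM' : (↑(hM.unit⁻¹) * P) * M = P := by
    rw [mul_assoc, ← hMP, ← mul_assoc, IsUnit.val_inv_mul, one_mul]
  have hMγ' : M * ↑(hM.unit⁻¹) * P = P := by
    rw [IsUnit.mul_val_inv, one_mul]
  have hγM : ∀ v, γ (M v) = P v := fun v => by
    rw [hγ, ← Module.End.mul_apply, ← Module.End.mul_apply, hγM']
  have hMγ : ∀ v, M (γ v) = P v := fun v => by
    rw [hγ, ← Module.End.mul_apply, ← Module.End.mul_apply, hMγ']
  have hγinvP : ∀ v, γ.symm (P v) = M v := fun v => by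
    rw [← hγM, LinearEquiv.symm_apply_apply]
  -- `γ` is an isometry
  have hγiso : ∀ u w, B (γ u) (γ w) = B u w := by
    intro u w
    obtain ⟨u₁, rfl⟩ : ∃ u₁, M u₁ = u := ⟨(↑(hM.unit⁻¹) : Module.End K V) u, by
      rw [← Module.End.mul_apply, IsUnit.mul_val_inv, Module.End.one_apply]⟩
    obtain ⟨w₁, rfl⟩ : ∃ w₁, M w₁ = w := ⟨(↑(hM.unit⁻¹) : Module.End K V) w, by
      rw [← Module.End.mul_apply, IsUnit.mul_val_inv, Module.End.one_apply]⟩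
    rw [hγM, hγM]
    exact form_two_smul_add_eq B c hc u₁ w₁
  -- `n(c)` as a linear automorphism of `𝔻`, with inverse `n(−c)`, and `w₀`
  let nc : V × V →ₗ[K] V × V :=
    (LinearMap.fst K V V + c ∘ₗ (LinearMap.fst K V V - LinearMap.snd K V V)).prod
      (LinearMap.snd K V V + c ∘ₗ (LinearMap.fst K V V - LinearMap.snd K V V))
  let nc' : V × V →ₗ[K] V × V :=
    (LinearMap.fst K V V - c ∘ₗ (LinearMap.fst K V V - LinearMap.snd K V V)).prod
      (LinearMap.snd K V V - c ∘ₗ (LinearMap.fst K V V - LinearMap.snd K V V))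
  have hnc : ∀ x : V × V, nc x = (x.1 + c (x.1 - x.2), x.2 + c (x.1 - x.2)) := fun x => rfl
  have hnc' : ∀ x : V × V, nc' x = (x.1 - c (x.1 - x.2), x.2 - c (x.1 - x.2)) := fun x => rfl
  have h₁ : nc ∘ₗ nc' = LinearMap.id := by
    ext x <;> simp [hnc, hnc']
  have h₂ : nc' ∘ₗ nc = LinearMap.id := by
    ext x <;> simp [hnc, hnc']
  let nE : (V × V) ≃ₗ[K] (V × V) := LinearEquiv.ofLinear nc nc' h₁ h₂
  let w₀ : (V × V) ≃ₗ[K] (V × V) := (LinearEquiv.refl K V).prodCongr (LinearEquiv.neg K)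
  let p : (V × V) ≃ₗ[K] (V × V) := (γ.symm.prodCongr (LinearEquiv.refl K V)).trans (nE.trans w₀)
  have hp : ∀ a b : V, p (a, b) = (γ.symm a + c (γ.symm a - b), -(b + c (γ.symm a - b))) := fun a b => rfl
  refine ⟨γ, p, hγM, hγiso, ?_, ?_, ?_, ?_⟩
  · -- `p` is an isometry of `H`
    intro x y
    obtain ⟨a, b⟩ := x
    obtain ⟨a', b'⟩ := y
    rw [hp, hp]
    dsimp only
    rw [doubledForm_longElement, doubledForm_smear B c hc]
    have e := hγiso (γ.symm a) (γ.symm a')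
    rw [LinearEquiv.apply_symm_apply, LinearEquiv.apply_symm_apply] at e
    rw [e]
  · -- `p (v, v) ∈ Δ`
    intro v
    rw [hp]
    dsimp only
    set u := γ.symm v with hu
    have hv : γ u = v := by rw [hu, LinearEquiv.apply_symm_apply]
    have key : P u - M v = 0 := by rw [← hMγ, hv, sub_self]
    rw [hMdef, hPdef] at key
    simp only [LinearMap.sub_apply, LinearMap.add_apply, LinearMap.smul_apply, Module.End.one_apply] at key
    rw [map_sub, ← sub_eq_zero]
    linear_combination (norm := module) key
  · -- every `(w, w)` is attained: `p (−P w, −P w) = (w, w)`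
    intro w
    refine ⟨-(P w), ?_⟩
    rw [hp, map_neg, hγinvP]
    rw [hMdef, hPdef]
    ext <;> simp [LinearMap.sub_apply, LinearMap.add_apply, two_smul] <;> abel
  · -- the factorisation `w₀ n(c) = p (γ ⊕ 1)`
    intro v₁ v₂
    rw [hp, LinearEquiv.symm_apply_apply]

/-- **The Lagrangian `n(c)⁻¹ w₀⁻¹ Δ` is the graph of the Cayley transform**: with `γ, p` as in
`exists_cayley_siegel_decomposition` (any `γ`, `p` satisfying the factorisation and `p Δ ⊆ Δ`),
`w₀ n(c) (u, γ u) ∈ Δ` for every `u`, i.e. `(u, γ u) ∈ n(c)⁻¹ w₀⁻¹ Δ`. [cite: MoeglinVignerasWaldspurger1987, Ch. 3] -/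
theorem smear_graph_mem_diag (c : V →ₗ[K] V) (γ : V ≃ₗ[K] V) (p : (V × V) ≃ₗ[K] (V × V))
    (hpΔ : ∀ v : V, (p (v, v)).1 = (p (v, v)).2)
    (hfac : ∀ v₁ v₂ : V, p (γ v₁, v₂) = (v₁ + c (v₁ - v₂), -(v₂ + c (v₁ - v₂)))) (u : V) :
    u + c (u - γ u) = -(γ u + c (u - γ u)) := by
  have e := hfac u (γ u)
  have h1 := hpΔ (γ u)
  rw [e] at h1
  exact h1

/-! ### The invertibility condition is polynomial -/

/-- In finite dimension, `2c − 1` and `2c + 1` are both invertible iff `det(2c − 1) · det(2c + 1) ≠ 0` (the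
complement of the zero locus of a polynomial in `c`). [cite: MoeglinVignerasWaldspurger1987, Ch. 3] -/
theorem isUnit_and_isUnit_iff_det_ne_zero [Module.Finite K V] (c : V →ₗ[K] V) :
    IsUnit ((2 : K) • c - 1 : Module.End K V) ∧ IsUnit ((2 : K) • c + 1 : Module.End K V) ↔
      LinearMap.det ((2 : K) • c - 1 : Module.End K V) * LinearMap.det ((2 : K) • c + 1 : Module.End K V) ≠ 0 := by
  rw [mul_ne_zero_iff, LinearMap.isUnit_iff_isUnit_det, LinearMap.isUnit_iff_isUnit_det, isUnit_iff_ne_zero,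
    isUnit_iff_ne_zero]

end Literature.LinearAlgebra.Semilinear
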